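import Mathlib.LinearAlgebra.Span.Basic
import Mathlib.Algebra.Module.Submodule.Ker
import Mathlib.Algebra.Module.Submodule.Range
import Mathlib.Algebra.Module.Submodule.Map
import Mathlib.Tactic.Module
import Mathlib.Tactic.Linarith
import Mathlib.Algebra.Order.Field.Basic
import Mathlib.LinearAlgebra.Quotient.Basic
import Mathlib.RingTheory.Ideal.Defs
import HarnessLib

/-!
# Markman's criterion for semiregularity and its weak form (arXiv:2502.03415 Lemma 8.3.4, Remark 8.3.5;
# arXiv:2509.23403 Lemma 11.3, Question 11.4): the linear algebra, and its first-order consequences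

Family `hodge`, layer `Literature/AlgebraicGeometry/HodgeTheory`. Fully PROVED statements (no named fact, no new
definition): the abstract skeleton of

* E. Markman, *Cycles on abelian 2n-folds of Weil type from secant sheaves on abelian n-folds*, arXiv:2502.03415
  (2025, unrefereed) [`Markman2025SecantWeil`], §8.3, diagram (8.3.3) and **Lemma 8.3.4** (v2 PDF p. 59; held text chunk 47),
  verbatim: "If the kernels of `ob_E` and `⌟ch(E)` in `HT²(M)` are equal and `ob_E` is surjective, then `E` is
  semiregular." with its proof "The hypotheses imply that there exists a unique injective map `σ'` … such that
  `⌟ch(E) = σ' ∘ ob_E`. The equality `σ = σ'` follows from the commutativity of Diagram (8.3.3)."; **Remark 8.3.5**: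
  "If we drop the assumption that `ob_E` is surjective in Lemma 8.3.4 we still conclude that the semiregularity map
  restricts to the image of the obstruction map as an injective map."
* E. Markman, *Secant sheaves and Weil classes on abelian varieties*, arXiv:2509.23403 [`Markman2025SurveySecant`],
  **Lemma 11.3** (chunk 18, the same statement with `ev_E : HH²(Y) → Hom(E,E[2])`) and **Question 11.4**: "Is the
  surjectivity of `ev_E` needed in Lemma 11.3? Does the Semi-regularity Theorem 2.1 hold under the weaker assumption
  that `σ_E` restricts to the image of `ev_E` as an injective map …?"
* R.-O. Buchweitz, H. Flenner, Compositio Math. 137 (2003) [`BuchweitzFlenner2003`], §1 (chunk 4) and Cor. 4.3: the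
  commutative triangle `σ_k ∘ ⟨*, -At(F)⟩ = ⟨*, ch_{k+1}(F)⟩` on `H¹(X, Θ_X)`, where `ob := ⟨*, -At(F)⟩ :
  H¹(X, Θ_X) → Ext²_X(F, F)` is such that "`F` admits a deformation into the direction of `ξ` if and only if
  `ob(ξ) = 0`" ([Ill], (3.4) there), and "the unique horizontal lift of `ch_{k+1}(F)` relative to the Gauß–Manin
  connection stays of Hodge type `(k+1, k+1)` if and only if `⟨ξ, ch_{k+1}(F)⟩ = 0`".

## Dictionary (what the abstract modules stand for; none of these carriers exists in the tree — see the ladder's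
## DIVERGENCE.md D5)

* `H` = `HT²(M) = H²(𝒪_M) ⊕ H¹(T_M) ⊕ H⁰(∧²T_M) ≅ HH²(M)` (first-order deformations of `D^b(M)`), with the
  distinguished submodule `T = H¹(T_M)` of commutative (Kodaira–Spencer) directions;
* `E` = `Ext²(E, E)`; `Ω = ⊕_{q ≥ 0} H^{q+2}(M, Ω^q_M)`;
* `ev : H →ₗ E` = Markman's `ob_E = ev_E` (evaluation of a Hochschild class on `E`; on `H¹(T_M)` it is
  `ξ ↦ ⟨ξ, -At(E)⟩`, the first-order obstruction);
* `σ : E →ₗ Ω` = the semiregularity map `(Tr(· ∘ At^q/q!))_q`;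
* `c : H →ₗ Ω` = contraction with the Chern character, `η ↦ η ⌟ ch(E)` (composed with HKR);
* `hcomm : σ ∘ₗ ev = c` = the commutativity of Markman's diagram (8.3.3) (on `T` this is BF Cor. 4.3; on the other
  two summands it is proved in [Markman2025SecantWeil, §8.3] for abelian `M`).

In this language: "`E` semiregular" = `Function.Injective σ`; Markman's WEAK criterion (the hypothesis of Question 11.4)
= "`σ` is injective on `range ev`" = `∀ η, σ (ev η) = 0 → ev η = 0`; "kernel of `ob_E` = annihilator of `ch(E)`"
= `ker ev = ker c`.

## What is proved (all elementary; the point is the exact logical shape)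

* `ker_ev_le_ker_contract` : `hcomm` alone gives `ker ev ≤ ker c`.
* `weakCriterion_iff_ker_contract_le_ker_ev` : GIVEN `hcomm`, the weak criterion is EQUIVALENT to `ker c ≤ ker ev`
  (hence to `ker ev = ker c`): Remark 8.3.5 and its converse.
* `semiregular_of_ker_eq_of_surjective` : Lemma 8.3.4 / Lemma 11.3.
* `ev_eq_zero_of_contract_eq_zero` : **first-order consequence of the weak criterion** — every `η` with
  `η ⌟ ch(E) = 0` has `ev η = 0`. Read on `T = H¹(T_M)` through BF §1: under the weak criterion, `E` lifts to FIRST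
  order along every Kodaira–Spencer class keeping `ch(E)` of Hodge type to first order. This is the (only) part of
  Question 11.4 that holds for formal reasons; the ladder note `papers/HodgeConjecture/hodge-weil-ladder` (P1) uses its
  contrapositive `not_weakCriterion_of_witness` as the engine of two no-go theorems for genus-4 secant sheaves.
* `not_injOn_of_witness` : the same witness kills injectivity of `σ` on ANY submodule `V ⊇ range ev` — in particular on
  invariants `Ext²(E,E)^G ⊇ im(ev_E)` of a group acting trivially on `HT²` (Markman §11.4: "`σ_𝓔` restricts as an
  injective map to `Ext²(𝓔,𝓔)^Ḡ`, which contains the image of `ev_𝓔`"), and plain semiregularity (`V = ⊤`).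
* `obstruction_eq_zero_of_weakCriterion` : the reduction step behind a partial positive answer to Question 11.4: if an
  obstruction class `ob` lies in `ker σ` (Buchweitz–Flenner, proof of Prop. 5.9: the semiregularity map sends the
  obstruction to the obstruction against the horizontal lift of `ch` staying in the Hodge filtration) and differs from a
  VANISHING obstruction `ob'` (for some other extension of the same thickening) by an element of `ev(T)` (Huybrechts–
  Thomas: obstructions are `At · κ`, and two extensions differ by a class in `H¹(T) ⊗ I`), then the weak criterion on `T`
  forces `ob = 0`.

## What is NOT here

No geometry: Hochschild cohomology, Atiyah classes on `Ext²` of coherent sheaves, Kodaira–Spencer classes and the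
commutativity (8.3.3) are not tree carriers (the tree's `sigmaHigher` / `IsISemiregular` of `SemiregularityHigherSigma`
cover finite locally free `E` only). An answer to Question 11.4 itself (a deformation-theoretic statement to all orders)
is not claimed in either direction.
-/

namespace Literature.AlgebraicGeometry.HodgeTheory

section WeakCriterion

variable {R : Type*} [CommRing R]
variable {H E Ω : Type*} [AddCommGroup H] [Module R H] [AddCommGroup E] [Module R E]
  [AddCommGroup Ω] [Module R Ω]
variable (ev : H →ₗ[R] E) (σ : E →ₗ[R] Ω) (c : H →ₗ[R] Ω)

/-- From the commutative triangle `σ ∘ ev = c` (Markman's diagram (8.3.3); on `H¹(T_M)` Buchweitz–Flenner Cor. 4.3)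
alone: `ker ev ≤ ker c` — a direction along which `E` lifts to first order keeps `ch(E)` of Hodge type to first
order ("The kernel of `ob_E` is contained in the kernel of [`⌟ch`], by [Huang]", Markman §8.3).
[cite: Markman2025SecantWeil, §8.3 diagram (8.3.3)] -/
theorem ker_ev_le_ker_contract (hcomm : σ ∘ₗ ev = c) : LinearMap.ker ev ≤ LinearMap.ker c := by
  intro η hη
  rw [LinearMap.mem_ker] at hη ⊢
  rw [← hcomm, LinearMap.comp_apply, hη, map_zero]

/-- **Remark 8.3.5 and its converse.** Given the commutative triangle `σ ∘ ev = c`, Markman's WEAK criterion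
"the semiregularity map restricts to the image of the obstruction map as an injective map" (spelled: `σ (ev η) = 0`
forces `ev η = 0`) holds if and only if `ker c ≤ ker ev`, i.e. (with `ker_ev_le_ker_contract`) iff "the kernels of
`ob_E` and `⌟ch(E)` are equal". [cite: Markman2025SecantWeil, Remark 8.3.5] -/
theorem weakCriterion_iff_ker_contract_le_ker_ev (hcomm : σ ∘ₗ ev = c) :
    (∀ η : H, σ (ev η) = 0 → ev η = 0) ↔ LinearMap.ker c ≤ LinearMap.ker ev := by
  constructor
  · intro hW η hη
    rw [LinearMap.mem_ker] at hη ⊢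
    apply hW
    rw [← LinearMap.comp_apply, hcomm, hη]
  · intro hle η hσ
    have hη : η ∈ LinearMap.ker c := by
      rw [LinearMap.mem_ker, ← hcomm, LinearMap.comp_apply, hσ]
    exact LinearMap.mem_ker.mp (hle hη)

/-- The weak criterion as injectivity on the range: `σ` is injective on `range ev` iff `σ (ev η) = 0 → ev η = 0`
for all `η` (linear maps). [folklore] -/
theorem injOn_range_iff_weakCriterion :
    Set.InjOn σ (LinearMap.range ev : Set E) ↔ ∀ η : H, σ (ev η) = 0 → ev η = 0 := by
  constructor
  · intro hinj η hσ
    have h0 : (0 : E) ∈ (LinearMap.range ev : Set E) := (LinearMap.range ev).zero_mem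
    exact hinj (LinearMap.mem_range_self ev η) h0 (by rw [hσ, map_zero])
  · intro hW x hx y hy hxy
    obtain ⟨a, rfl⟩ := LinearMap.mem_range.mp hx
    obtain ⟨b, rfl⟩ := LinearMap.mem_range.mp hy
    have h : ev (a - b) = 0 := hW (a - b) (by rw [map_sub, map_sub, hxy, sub_self])
    rwa [map_sub, sub_eq_zero] at h

/-- **Markman, Lemma 8.3.4 (= survey Lemma 11.3).** "If the kernels of `ob_E` and `⌟ch(E)` in `HT²(M)` are equal
and `ob_E` is surjective, then `E` is semiregular": with `σ ∘ ev = c`, `ker c ≤ ker ev` and `ev` surjective, the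
semiregularity map `σ` is injective. (Markman's proof: `c` factors through the quotient `ev` as an injective `σ'`,
and `σ' = σ` by (8.3.3).) [cite: Markman2025SecantWeil, Lemma 8.3.4] -/
theorem semiregular_of_ker_eq_of_surjective (hcomm : σ ∘ₗ ev = c)
    (hker : LinearMap.ker c ≤ LinearMap.ker ev) (hsurj : Function.Surjective ev) :
    Function.Injective σ := by
  rw [← LinearMap.ker_eq_bot, Submodule.eq_bot_iff]
  intro x hx
  obtain ⟨η, rfl⟩ := hsurj x
  exact (weakCriterion_iff_ker_contract_le_ker_ev ev σ c hcomm).mpr hker η (LinearMap.mem_ker.mp hx)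

/-- **First-order consequence of the weak criterion.** If `σ` is injective on `range ev` then every `η ∈ HT²(M)`
annihilating `ch(E)` (`c η = 0`) has `ev η = 0`. On the Kodaira–Spencer summand `H¹(T_M)` this reads, through
Buchweitz–Flenner §1 ("`F` admits a deformation into the direction of `ξ` if and only if `ob(ξ) = 0`"; "the unique
horizontal lift of `ch_{k+1}(F)` … stays of Hodge type … if and only if `⟨ξ, ch_{k+1}(F)⟩ = 0`"): under Markman's weak
criterion `E` lifts to first order along EVERY first-order deformation of `M` keeping `ch(E)` of Hodge type to first
order. [cite: BuchweitzFlenner2003, §1 and Cor. 4.3] -/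
theorem ev_eq_zero_of_contract_eq_zero (hcomm : σ ∘ₗ ev = c)
    (hW : ∀ η : H, σ (ev η) = 0 → ev η = 0) {η : H} (hη : c η = 0) : ev η = 0 :=
  LinearMap.mem_ker.mp
    ((weakCriterion_iff_ker_contract_le_ker_ev ev σ c hcomm).mp hW (LinearMap.mem_ker.mpr hη))

/-- **No-go template.** A single `η` with `η ⌟ ch(E) = 0` but `ev η ≠ 0` (a first-order deformation of `M`, or of
`D^b(M)`, keeping `ch(E)` Hodge to first order along which `E` does NOT lift) refutes Markman's weak criterion for `E`.
[cite: Markman2025SecantWeil, Remark 8.3.5] -/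
theorem not_weakCriterion_of_witness (hcomm : σ ∘ₗ ev = c) {η : H} (hη : c η = 0) (hev : ev η ≠ 0) :
    ¬ ∀ η' : H, σ (ev η') = 0 → ev η' = 0 :=
  fun hW => hev (ev_eq_zero_of_contract_eq_zero ev σ c hcomm hW hη)

/-- **The same witness kills every stronger injectivity.** If `c η = 0` and `ev η ≠ 0`, then `σ` is not injective on
any submodule `V` of `Ext²(E,E)` containing `range ev` — e.g. `V = Ext²(E,E)^G` for a group `G` acting trivially on
`HT²(M)` (Markman, arXiv:2509.23403 §11.4: "`Ext²(𝓔,𝓔)^Ḡ`, which contains the image of `ev_𝓔`"; equivariant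
semiregularity), or `V = ⊤` (semiregularity itself). [cite: Markman2025SurveySecant, §11.4] -/
theorem not_injOn_of_witness (hcomm : σ ∘ₗ ev = c) {η : H} (hη : c η = 0) (hev : ev η ≠ 0)
    (V : Submodule R E) (hV : LinearMap.range ev ≤ V) : ¬ Set.InjOn σ (V : Set E) := by
  intro hinj
  have hσ : σ (ev η) = σ 0 := by rw [← LinearMap.comp_apply, hcomm, hη, map_zero]
  exact hev (hinj (hV (LinearMap.mem_range_self ev η)) V.zero_mem hσ)

/-- In particular such a witness shows `E` is NOT semiregular (`σ` not injective).
[cite: Markman2025SecantWeil, Lemma 8.3.4] -/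
theorem not_semiregular_of_witness (hcomm : σ ∘ₗ ev = c) {η : H} (hη : c η = 0) (hev : ev η ≠ 0) :
    ¬ Function.Injective σ := fun hinj =>
  not_injOn_of_witness ev σ c hcomm hη hev ⊤ le_top (fun _ _ _ _ hxy => hinj hxy)

/-- **Reduction step toward Question 11.4 (partial positive answer).** Let `T ≤ HT²(M)` (the Kodaira–Spencer
directions) and assume the weak criterion on `ev(T)`. If an obstruction class `ob ∈ Ext²(E,E)` satisfies `σ ob = 0`
(Buchweitz–Flenner, proof of Prop. 5.9: this holds for the obstruction to extending a deformation of `E` along a family on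
which `ch(E)` stays of Hodge type) and `ob - ob' ∈ ev(T)` for a second obstruction class `ob'` which VANISHES (the same
partial deformation of `E` extends over SOME other extension of the thickened variety; two extensions differ by a class
of `H¹(T) ⊗ I` and the obstructions by its image under `ev`, Huybrechts–Thomas Cor. 3.4), then `ob = 0`: the deformation
of `E` extends along the given family as well. [cite: BuchweitzFlenner2003, Prop. 5.9 (proof) and Thm. 5.1] -/
theorem obstruction_eq_zero_of_weakCriterion (T : Submodule R H)
    (hW : ∀ η ∈ T, σ (ev η) = 0 → ev η = 0) {ob ob' : E} (hσ : σ ob = 0) (hob' : ob' = 0)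
    (hdiff : ob - ob' ∈ T.map ev) : ob = 0 := by
  subst hob'
  rw [sub_zero] at hdiff
  obtain ⟨η, hηT, rfl⟩ := Submodule.mem_map.mp hdiff
  exact hW η hηT hσ

end WeakCriterion

/-! ## Appendix (ladder note P1, generation 2): the annihilator of a secant class, and the weak criterion as a
## statement about PAIR obstructions

Two further pieces of pure linear algebra used by the ladder note `papers/HodgeConjecture/hodge-weil-ladder`
(sections "Proposition D / Corollary D′" and "Theorem F"). As above nothing geometric is asserted; the docstrings say
which published identity discharges each hypothesis.

### The secant system (Proposition D)

Setting (Markman arXiv:2502.03415 Ex. 8.2.3, v2 PDF p. 52–53, chunks 43–44 of the held text: for a principally polarized abelian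
`n`-fold `(X, Θ)` and `K = ℚ(√-d)`, "`exp(√-d Θ) = α + √-d β`", e.g. for `n = 4`
"`α = 1 - (d/2)Θ² + (d²/4!)Θ⁴`, `β = Θ - (d/6)Θ³`"; a `K`-secant object `F` has `ch(F) ∈ span_ℚ(α, β)`).
Write `ch_j(F) = (M_j / j!) Θ^j`; then `ch(F) ∈ span(α, β)` iff `M_{j+2} = -d M_j` for all `j`, with
`(M₀, M₁) ∈ ℚ² ∖ 0`. For `η = (c, ξ, P) ∈ HT²(X) = H²(𝒪_X) ⊕ H¹(T_X) ⊕ H⁰(∧²T_X)` put `b := ι_ξ Θ` and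
`p := ι_P Θ²`, both in `H^{0,2}(X)`. Because `ι_ξ` is a derivation of the cohomology algebra (Buchweitz–Flenner,
Compositio 137 (2003) §4: "this gives a derivation `⟨ξ,*⟩` from the cohomology algebra") and `ι_P`, `P = v ∧ w`, is the
composite `ι_w ι_v` of two odd derivations (so `ι_P Θ^j = j(j-1)/2 · Θ^{j-2} ι_P Θ²`), the `H^{q,q+2}`-component of
`η ⌟ ch(F)` equals `(Θ^q/q!) ∧ w_q` with

  `w_q := M_q • c + M_{q+1} • b + (M_{q+2}/2) • p ∈ H^{0,2}(X)`,

and `Θ^q ∧ (-) : H^{0,2} → H^{q,q+2}` is injective for `q ≤ n - 2` (hard Lefschetz). Hence `η ⌟ ch(F) = 0` iff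
`w_q = 0` for `q = 0, …, n-2`. All scalars are rational, so `H^{0,2}(X)` may be regarded as a `ℚ`-vector space and the
theorems below (stated over any field, resp. any linearly ordered field for the determinant) apply verbatim:

* `secantSystem_solution`: the equations `w₀ = w₁ = 0` force `b = 0` and `c = (d/2) • p` as soon as
  `d M₀² + M₁² ≠ 0` (`secantDet_ne_zero`: automatic for `d > 0`, `(M₀, M₁) ≠ 0` over an ordered field);
* `secantSystem_of_solution`: conversely `b = 0`, `c = (d/2) • p` solve `w_q = 0` for EVERY `q`.

Geometric reading (the ladder note's Corollary D′; needs `n ≥ 3` so that `q = 0, 1 ≤ n - 2`): the annihilator of a secant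
class in `HT²(X)` is exactly {`(0, ξ, 0)` : `ι_ξ Θ = 0`} (first-order deformations of `(X, Θ)` as a principally polarized
abelian variety, dimension `n(n+1)/2`) ⊕ {`η_P := ((d/2) ι_P Θ², 0, P)` : `P ∈ ∧² T₀X`} (dimension `n(n-1)/2`), of total
dimension `n²`; granting Markman's commutativity (8.3.3), his weak criterion for a `K`-secant object is therefore the
conjunction of (a) first-order liftability along every principally polarized direction and (b) first-order liftability
along every "spinorial" noncommutative direction `η_P` (a Poisson bivector coupled with a gerbe class).

### The weak criterion and pair obstructions (Theorem F)

`weakCriterion_iff_disjoint`: Markman's weak criterion says precisely that `range ev` and `ker σ` are DISJOINT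
submodules of `Ext²(E,E)`. `obstruction_eq_zero_iff_class_eq_zero`: consequently an obstruction class `o` with `σ o = 0` —
which is where every obstruction to extending a deformation of `E` along a family keeping `ch(E)` Hodge lies
(Buchweitz–Flenner Prop. 5.9; Pridham; used verbatim in the last paragraph of the proof of A. Perry, arXiv:2604.00511
Thm. 4.1: "since `E₀` is semiregular, we find that `σ²_{E,I}` is injective. Since … `σ²_{E,I}` also kills `ob(E)`, we find
that `ob(E) = 0`") — vanishes if and only if its class in `coker(ev) = Ext²(E,E)/range ev` vanishes. That class is the
obstruction to extending the PAIR (space possibly noncommutative or gerby, sheaf) in any direction of `HT²(X₀) ⊗ I` at all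
(the long exact sequence `HT² →ev Ext²(E,E) → T²_pair → HT³` of the pair deformation problem). This is the exact content of
the reduction of Question 11.4 to "unobstructedness of pairs" and the precise place where injectivity of `σ` on ALL of
`Ext²(E,E)` (resp. `Ext²(E,E)^G`) enters the published proofs. -/

section SecantAnnihilator

variable {K : Type*} [Field K] {V : Type*} [AddCommGroup V] [Module K V]

/-- **Proposition D (the two decisive equations).** Over a field `K`, let `M : ℕ → K` satisfy the secant recursion
`M (q+2) = -d * M q` and let `b c p : V`. If the `H^{0,2}`- and `H^{1,3}`-equations
`M 0 • c + M 1 • b + (M 2 / 2) • p = 0` and `M 1 • c + M 2 • b + (M 3 / 2) • p = 0` hold and the determinant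
`d * M 0 ^ 2 + M 1 ^ 2` is non-zero, then `b = 0` and `c = (d/2) • p`: a class `(c, ξ, P) ∈ HT²(X)` annihilating a
secant Chern character has `ι_ξ Θ = 0` (a principally polarized direction) and gerbe part `(d/2) ι_P Θ²`.
[cite: Markman2025SecantWeil, Example 8.2.3 (secant classes) and §8.3 (8.3.3)] -/
theorem secantSystem_solution (d : K) (M : ℕ → K) (hM : ∀ q, M (q + 2) = -d * M q) (b c p : V)
    (hdet : d * M 0 ^ 2 + M 1 ^ 2 ≠ 0)
    (h0 : M 0 • c + M 1 • b + (M 2 / 2) • p = 0)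
    (h1 : M 1 • c + M 2 • b + (M 3 / 2) • p = 0) :
    b = 0 ∧ c = (d / 2) • p := by
  have hM2 : M 2 = -d * M 0 := hM 0
  have hM3 : M 3 = -d * M 1 := hM 1
  rw [hM2] at h0 h1
  rw [hM3] at h1
  -- eliminate `c - (d/2) • p`
  have hb : (d * M 0 ^ 2 + M 1 ^ 2) • b =
      M 1 • (M 0 • c + M 1 • b + (-d * M 0 / 2) • p) - M 0 • (M 1 • c + (-d * M 0) • b + (-d * M 1 / 2) • p) := by
    module
  rw [h0, h1, smul_zero, smul_zero, sub_zero] at hb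
  have hb0 : b = 0 := by
    rcases smul_eq_zero.mp hb with h | h
    · exact absurd h hdet
    · exact h
  subst hb0
  refine ⟨rfl, ?_⟩
  -- now `M 0 • (c - (d/2) • p) = 0` and `M 1 • (c - (d/2) • p) = 0`
  have hx0 : M 0 • (c - (d / 2) • p) = 0 := by
    rw [← h0]; module
  have hx1 : M 1 • (c - (d / 2) • p) = 0 := by
    rw [← h1]; module
  by_contra hne
  have hne' : c - (d / 2) • p ≠ 0 := sub_ne_zero.mpr hne
  have hM0 : M 0 = 0 := (smul_eq_zero.mp hx0).resolve_right hne'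
  have hM1 : M 1 = 0 := (smul_eq_zero.mp hx1).resolve_right hne'
  apply hdet
  rw [hM0, hM1]; ring

/-- **Proposition D (converse: consistency of all the equations).** With the secant recursion `M (q+2) = -d * M q`,
the values `b = 0`, `c = (d/2) • p` satisfy the `H^{q,q+2}`-equation `M q • c + M (q+1) • b + (M (q+2)/2) • p = 0` for
EVERY `q`: for each Poisson bivector `P` the class `η_P = ((d/2) ι_P Θ², 0, P)` annihilates every `K`-secant Chern
character, and so does every principally polarized Kodaira–Spencer class `(0, ξ, 0)`, `ι_ξ Θ = 0` (the case `p = 0`).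
[cite: Markman2025SecantWeil, §8.3 (8.3.3)] -/
theorem secantSystem_of_solution (d : K) (M : ℕ → K) (hM : ∀ q, M (q + 2) = -d * M q) (b c p : V)
    (hb : b = 0) (hc : c = (d / 2) • p) (q : ℕ) :
    M q • c + M (q + 1) • b + (M (q + 2) / 2) • p = 0 := by
  subst hb; subst hc
  rw [hM q, smul_zero, add_zero, smul_smul, ← add_smul]
  have : M q * (d / 2) + -d * M q / 2 = 0 := by ring
  rw [this, zero_smul]

/-- The determinant of the secant system is non-zero: over a linearly ordered field, `d > 0` and `(M₀, M₁) ≠ (0, 0)`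
give `d M₀² + M₁² ≠ 0` (for a `K`-secant object `ch(F) ≠ 0`, i.e. `(M₀, M₁) ≠ 0`, and `d > 0` as `K = ℚ(√-d)` is
imaginary quadratic). [folklore] -/
theorem secantDet_ne_zero {L : Type*} [Field L] [LinearOrder L] [IsStrictOrderedRing L] {d M₀ M₁ : L}
    (hd : 0 < d) (hM : M₀ ≠ 0 ∨ M₁ ≠ 0) : d * M₀ ^ 2 + M₁ ^ 2 ≠ 0 := by
  intro h
  have h0 : 0 ≤ d * M₀ ^ 2 := mul_nonneg hd.le (sq_nonneg M₀)
  have h1 : 0 ≤ M₁ ^ 2 := sq_nonneg M₁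
  have hM₁ : M₁ = 0 := by
    have : M₁ ^ 2 = 0 := le_antisymm (by linarith) h1
    exact pow_eq_zero_iff (two_ne_zero) |>.mp this
  have hM₀ : M₀ = 0 := by
    have : d * M₀ ^ 2 = 0 := by rw [hM₁] at h; simpa using h
    rcases mul_eq_zero.mp this with h' | h'
    · exact absurd h' hd.ne'
    · exact pow_eq_zero_iff (two_ne_zero) |>.mp h'
  rcases hM with h' | h'
  · exact h' hM₀
  · exact h' hM₁

/-- **Corollary D′ packaged.** For a `K`-secant class (`d > 0`, `(M₀, M₁) ≠ 0`, secant recursion) over a linearly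
ordered field acting on `V = H^{0,2}`: the first two equations of the system hold iff `b = 0 ∧ c = (d/2) • p`, and then
all equations hold. [cite: Markman2025SecantWeil, §8.3] -/
theorem secantSystem_iff {L : Type*} [Field L] [LinearOrder L] [IsStrictOrderedRing L] {W : Type*}
    [AddCommGroup W] [Module L W] (d : L) (hd : 0 < d) (M : ℕ → L) (hM : ∀ q, M (q + 2) = -d * M q)
    (hM01 : M 0 ≠ 0 ∨ M 1 ≠ 0) (b c p : W) :
    (M 0 • c + M 1 • b + (M 2 / 2) • p = 0 ∧ M 1 • c + M 2 • b + (M 3 / 2) • p = 0) ↔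
      (b = 0 ∧ c = (d / 2) • p) := by
  constructor
  · rintro ⟨h0, h1⟩
    exact secantSystem_solution d M hM b c p (secantDet_ne_zero hd hM01) h0 h1
  · rintro ⟨hb, hc⟩
    exact ⟨secantSystem_of_solution d M hM b c p hb hc 0, secantSystem_of_solution d M hM b c p hb hc 1⟩

end SecantAnnihilator

section PairObstruction

variable {R : Type*} [CommRing R]
variable {H E Ω : Type*} [AddCommGroup H] [Module R H] [AddCommGroup E] [Module R E]
  [AddCommGroup Ω] [Module R Ω]
variable (ev : H →ₗ[R] E) (σ : E →ₗ[R] Ω)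

/-- **The weak criterion is a disjointness statement.** `σ` is injective on `range ev` (Markman's weak criterion,
hypothesis of Question 11.4) iff the submodules `range ev` ("what first-order deformations of the space, commutative or
not, can do to `E`") and `ker σ` ("what Hodge theory cannot see") of `Ext²(E,E)` are disjoint.
[cite: Markman2025SurveySecant, Question 11.4] -/
theorem weakCriterion_iff_disjoint :
    (∀ η : H, σ (ev η) = 0 → ev η = 0) ↔ Disjoint (LinearMap.range ev) (LinearMap.ker σ) := by
  rw [Submodule.disjoint_def]
  constructor
  · intro hW x hx hσ
    obtain ⟨η, rfl⟩ := LinearMap.mem_range.mp hx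
    exact hW η (LinearMap.mem_ker.mp hσ)
  · intro hD η hσ
    exact hD (ev η) (LinearMap.mem_range_self ev η) (LinearMap.mem_ker.mpr hσ)

/-- **Theorem F (where injectivity of `σ` is really used).** Under the weak criterion, an obstruction class `o` killed
by the semiregularity map (`σ o = 0`: Buchweitz–Flenner Prop. 5.9 / Pridham, as used in the last step of the proof of
Perry, arXiv:2604.00511 Thm. 4.1) vanishes if and only if its image in `coker(ev) = Ext²(E,E) ⧸ range ev` vanishes —
i.e. iff the corresponding PAIR (space, allowed to move in every direction of `HT²`, together with the sheaf) is
unobstructed at this order. Full semiregularity makes the left side automatic; the weak criterion only converts the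
sheaf obstruction into a pair obstruction. [cite: BuchweitzFlenner2003, Prop. 5.9 (proof)] -/
theorem obstruction_eq_zero_iff_class_eq_zero (hW : ∀ η : H, σ (ev η) = 0 → ev η = 0) {o : E}
    (hσ : σ o = 0) : o = 0 ↔ (LinearMap.range ev).mkQ o = 0 := by
  constructor
  · intro h
    rw [h, map_zero]
  · intro h
    have ho : o ∈ LinearMap.range ev := by
      rw [← Submodule.ker_mkQ (LinearMap.range ev)]
      exact LinearMap.mem_ker.mpr h
    obtain ⟨η, rfl⟩ := LinearMap.mem_range.mp ho
    exact hW η hσ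

/-- Contrapositive form used for counterexample hunting: under the weak criterion, a NON-ZERO obstruction class killed by
`σ` has non-zero image in `coker(ev)` — a counterexample to Question 11.4 must exhibit an obstructed pair, never merely an
obstructed sheaf. [cite: Markman2025SurveySecant, Question 11.4] -/
theorem class_ne_zero_of_obstruction_ne_zero (hW : ∀ η : H, σ (ev η) = 0 → ev η = 0) {o : E}
    (hσ : σ o = 0) (ho : o ≠ 0) : (LinearMap.range ev).mkQ o ≠ 0 :=
  fun h => ho ((obstruction_eq_zero_iff_class_eq_zero ev σ hW hσ).mpr h)

end PairObstruction

section SecantAnnihilatorCM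

/-! ### The secant system for a CM field (ladder note P1, Proposition D_K)

Setting of E. Markman, arXiv:2509.23079 §11.1 (unrefereed; "§12.1" in the held chunk numbering): `X` simple abelian with real multiplication by a totally real
field `F` of degree `f`, `Θ = Σ_σ̂ Θ_σ̂ ∈ ∧²_F H¹(X,ℚ)`, `K = F(√-q)` with `q ∈ F` totally positive, and the `2^f`-dimensional
secant space `B` spanned by the pure spinors `ℓ_T = exp(Σ_σ̂ z^T_σ̂ Θ_σ̂)`, `z^T_σ̂ = ± i √(σ̂ q)` (all sign patterns `T`). For
`η = (c, ξ, P) ∈ HT²(X)` one has `η ⌟ ℓ_T = q_η(z^T) ∧ ℓ_T` with the `H^{0,2}`-valued quadratic polynomial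
`q_η(z) = c + Σ_σ̂ z_σ̂ ι_ξΘ_σ̂ + ½ ι_P((Σ_σ̂ z_σ̂Θ_σ̂)²)`, so `ann(B) = {η : q_η(z^T) = 0 ∀ T}`. Splitting into the isotypic
components of `H^{0,2} = ⊕_σ̂ ∧²U_σ̂ ⊕ ⊕_{σ̂<τ̂} U_σ̂ ⊗ U_τ̂` gives, per component, exactly the two finite sign systems solved
below (with `j = i√(σ̂ q) ≠ 0`, resp. `x = i√(σ̂ q)·b'`, `y = i√(τ̂ q)·b''`, `w = -√(σ̂ q)√(τ̂ q)·p`); the outcome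
`ann(B) = {polarized-RM Kodaira–Spencer classes} ⊕ {η^K_P : P ∈ ⊕_σ̂ ∧² V_σ̂}` of dimension `f·m(m+1)/2 + f·m(m-1)/2 = n²/f`
(`m = n/f`), the dimension of the period domain of `K`-Weil abelian `2n`-folds of split type, is derived from them in the ladder note
(DESIGN-SPACE.md §6). Only the elimination is kernel-checked here. -/

variable {K : Type*} [Field K] {V : Type*} [AddCommGroup V] [Module K V]

/-- **Diagonal component (σ̂ = τ̂) of the CM secant system.** If `c + j • b - r • p = 0` and `c - j • b - r • p = 0` with `j ≠ 0`
and `2 ≠ 0` in the field (`j = i√(σ̂ q)`, `r = σ̂(q)/2`), then `b = 0` and `c = r • p`: the `∧²U_σ̂`-part of a class annihilating the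
secant space has `Θ_σ̂`-symmetric Kodaira–Spencer component and gerbe part `(σ̂ q / 2)·ι_{P_σ̂}(Θ_σ̂²)`.
[cite: Markman2025SecantRealMultiplication, §11.1] -/
theorem cmSecant_diag_solution (h2 : (2 : K) ≠ 0) {j : K} (hj : j ≠ 0) (r : K) (b c p : V)
    (hplus : c + j • b - r • p = 0) (hminus : c - j • b - r • p = 0) : b = 0 ∧ c = r • p := by
  have hb : (2 * j) • b = (c + j • b - r • p) - (c - j • b - r • p) := by module
  rw [hplus, hminus, sub_zero] at hb
  have hb0 : b = 0 := by
    rcases smul_eq_zero.mp hb with h | h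
    · exact absurd h (mul_ne_zero h2 hj)
    · exact h
  subst hb0
  refine ⟨rfl, ?_⟩
  have hc : (2 : K) • (c - r • p) = (c + j • (0 : V) - r • p) + (c - j • (0 : V) - r • p) := by module
  rw [hplus, hminus, add_zero] at hc
  rcases smul_eq_zero.mp hc with h | h
  · exact absurd h h2
  · exact sub_eq_zero.mp h

/-- **Off-diagonal component (σ̂ ≠ τ̂) of the CM secant system.** If `c + ε₁ • x + ε₂ • y + (ε₁ * ε₂) • w = 0` for all four sign
choices `ε₁, ε₂ ∈ {1, -1}` and `2 ≠ 0` in the field, then `c = x = y = w = 0`. With `x = i√(σ̂ q)·ι_{ξ_τ̂σ̂}Θ_σ̂`,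
`y = i√(τ̂ q)·ι_{ξ_σ̂τ̂}Θ_τ̂`, `w = -√(σ̂ q)√(τ̂ q)·ι_P(Θ_σ̂Θ_τ̂)`: every class annihilating the secant space has no mixed gerbe part,
no RM-destroying Kodaira–Spencer part, and no mixed (`V_σ̂ ⊗ V_τ̂`) Poisson part. [cite: Markman2025SecantRealMultiplication, §11.1] -/
theorem cmSecant_offdiag_solution (h2 : (2 : K) ≠ 0) (c x y w : V)
    (h : ∀ ε₁ ε₂ : K, (ε₁ = 1 ∨ ε₁ = -1) → (ε₂ = 1 ∨ ε₂ = -1) →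
      c + ε₁ • x + ε₂ • y + (ε₁ * ε₂) • w = 0) :
    c = 0 ∧ x = 0 ∧ y = 0 ∧ w = 0 := by
  have h4 : (4 : K) ≠ 0 := by
    have : (4 : K) = 2 * 2 := by norm_num
    rw [this]; exact mul_ne_zero h2 h2
  have hpp := h 1 1 (Or.inl rfl) (Or.inl rfl)
  have hpm := h 1 (-1) (Or.inl rfl) (Or.inr rfl)
  have hmp := h (-1) 1 (Or.inr rfl) (Or.inl rfl)
  have hmm := h (-1) (-1) (Or.inr rfl) (Or.inr rfl)
  have ec : (4 : K) • c = (c + (1:K) • x + (1:K) • y + ((1:K) * 1) • w) + (c + (1:K) • x + (-1:K) • y + ((1:K) * -1) • w)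
      + (c + (-1:K) • x + (1:K) • y + ((-1:K) * 1) • w) + (c + (-1:K) • x + (-1:K) • y + ((-1:K) * -1) • w) := by module
  have ex : (4 : K) • x = (c + (1:K) • x + (1:K) • y + ((1:K) * 1) • w) + (c + (1:K) • x + (-1:K) • y + ((1:K) * -1) • w)
      - (c + (-1:K) • x + (1:K) • y + ((-1:K) * 1) • w) - (c + (-1:K) • x + (-1:K) • y + ((-1:K) * -1) • w) := by module
  have ey : (4 : K) • y = (c + (1:K) • x + (1:K) • y + ((1:K) * 1) • w) - (c + (1:K) • x + (-1:K) • y + ((1:K) * -1) • w)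
      + (c + (-1:K) • x + (1:K) • y + ((-1:K) * 1) • w) - (c + (-1:K) • x + (-1:K) • y + ((-1:K) * -1) • w) := by module
  have ew : (4 : K) • w = (c + (1:K) • x + (1:K) • y + ((1:K) * 1) • w) - (c + (1:K) • x + (-1:K) • y + ((1:K) * -1) • w)
      - (c + (-1:K) • x + (1:K) • y + ((-1:K) * 1) • w) + (c + (-1:K) • x + (-1:K) • y + ((-1:K) * -1) • w) := by module
  rw [hpp, hpm, hmp, hmm] at ec ex ey ew
  simp only [add_zero, sub_self] at ec ex ey ew
  refine ⟨?_, ?_, ?_, ?_⟩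
  · exact (smul_eq_zero.mp ec).resolve_left h4
  · exact (smul_eq_zero.mp ex).resolve_left h4
  · exact (smul_eq_zero.mp ey).resolve_left h4
  · exact (smul_eq_zero.mp ew).resolve_left h4

end SecantAnnihilatorCM

section PoissonCoisotropy

/-! ### The local obstruction along a Poisson (spinorial) direction: flat cyclic lifts force coisotropy
### (ladder note P1, gen-1 Theorem E Step 4; used by Theorems E, E′, E″ and the local dichotomy of gen 2)

Setting (Y. Toda, *Deformations and Fourier–Mukai transforms*, J. Differential Geom. 81 (2009), §4 and Prop. 6.1, held
as arXiv:math/0502571: the first-order noncommutative deformation of `𝒪_U` along a Poisson bivector `P` is the sheaf of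
algebras `(a + bε) ∗ (c + dε) := ac + (P(da, dc) + ad + bc)ε`; an object `F` with `u · exp(a(F)) = 0`, `u ∈ HT²`, lifts to a
perfect object of the deformation). Abstractly: `A` is a ring with an element `ε`, `ε² = 0`, such that `A/εA` is commutative
(`hcomm`: every commutator is a multiple of `ε`; for the star product `x ∗ y − y ∗ x = 2ε P(dx,dy)`), `J ⊆ A` a LEFT ideal
(Mathlib's `Ideal` of a non-commutative ring), so that `N := A/J` is a cyclic left module deforming `𝒪_U/I`, `I := (J + εA)/εA`.
Flatness of `N` over `ℂ[ε]` is `ker(ε · : N → N) = εN`, i.e. elementwise `ε a ∈ J → a ∈ J + εA` (`hflat`). Conclusion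
(`bracket_mem_of_flat_cyclic_lift`): for `x, y ∈ J` the commutator is `ε j` with `j ∈ J`, i.e. the Poisson bracket
`{x̄, ȳ}_P` of any two elements of `I` lies in `I`: the subscheme is COISOTROPIC for `P` at every point. Contrapositive
(`not_flat_of_bracket_witness`): two local equations of `Z` whose bracket is a unit modulo `I` (a smooth point `x ∈ Z` with
`P ∉ T_xZ ∧ T_xX`) forbid any `ℂ[ε]`-flat cyclic lift — the engine of gen-1 Theorem E (isolated points, non-planar curves in
a fourfold), E′ (the gluing curve of arXiv:2509.23079 Ex. 11.2.7) and, with one more syzygy, E″. -/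

/-- **Theorem E, Step 4 (flat cyclic lifts along a first-order noncommutative deformation force coisotropy).** Let `A` be a
ring, `ε ∈ A` with `ε * ε = 0`, such that all commutators are multiples of `ε` (the reduction `A/εA` is commutative), and let
`J` be a left ideal such that `A ⧸ J` is flat over the dual numbers in the elementwise form `ε a ∈ J → a ∈ J + εA`. Then for
`x, y ∈ J` one has `x y − y x = ε j` for some `j ∈ J`: the bracket of two equations of the subscheme is again an equation.
[cite: Toda2009DeformationsFM, §4 (star product) and Prop. 6.1] -/
theorem bracket_mem_of_flat_cyclic_lift {A : Type*} [Ring A] {ε : A} (hε2 : ε * ε = 0)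
    (hcomm : ∀ a b : A, ∃ c : A, a * b - b * a = ε * c) (J : Ideal A)
    (hflat : ∀ a : A, ε * a ∈ J → ∃ j ∈ J, ∃ b : A, a = j + ε * b)
    {x y : A} (hx : x ∈ J) (hy : y ∈ J) : ∃ j ∈ J, x * y - y * x = ε * j := by
  obtain ⟨c, hc⟩ := hcomm x y
  have hmem : ε * c ∈ J := by
    rw [← hc]
    exact J.sub_mem (J.mul_mem_left x hy) (J.mul_mem_left y hx)
  obtain ⟨j, hj, b, hb⟩ := hflat c hmem
  refine ⟨j, hj, ?_⟩
  rw [hc, hb, mul_add, ← mul_assoc, hε2, zero_mul, add_zero]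

/-- **Contrapositive: a non-coisotropic point kills every flat cyclic lift.** If `x, y ∈ J` have commutator `ε c` with
`c ∉ J + εA` (for Toda's star product: `{x̄, ȳ}_P ∉ I`, e.g. `x̄, ȳ` two of the local equations of a smooth `Z` at a point
where `P(dx̄, dȳ) ≠ 0` — always available when `P ∉ T_xZ ∧ T_xX`, in particular for isolated points and for curves in a
fourfold not tangent to a fixed plane), then `A ⧸ J` is NOT `ℂ[ε]`-flat: the structure sheaf `𝒪_Z` (and, by gen-1 Theorem E
Step 3, the ideal sheaf `𝓘_Z ⊗ L` when `codim Z ≥ 3`) does not lift to first order along the spinorial direction `η_P`.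
[cite: Toda2009DeformationsFM, Prop. 6.1] -/
theorem not_flat_of_bracket_witness {A : Type*} [Ring A] {ε : A} (J : Ideal A)
    {x y c : A} (hx : x ∈ J) (hy : y ∈ J) (hc : x * y - y * x = ε * c)
    (hnot : ∀ j ∈ J, ∀ b : A, c ≠ j + ε * b) :
    ¬ ∀ a : A, ε * a ∈ J → ∃ j ∈ J, ∃ b : A, a = j + ε * b := by
  intro hflat
  have hmem : ε * c ∈ J := by
    rw [← hc]
    exact J.sub_mem (J.mul_mem_left x hy) (J.mul_mem_left y hx)
  obtain ⟨j, hj, b, hb⟩ := hflat c hmem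
  exact hnot j hj b hb

end PoissonCoisotropy

section LocalLiftPdOne

/-! ### The positive half of the local dichotomy: projective dimension ≤ 1 lifts (ladder note P1 gen 2, Lemma J)

Setting as in `PoissonCoisotropy`: `A` a ring with `ε ∈ A`, `ε * ε = 0` (a first-order associative deformation of
`R = A/εA`, e.g. Toda's star product), all modules LEFT `A`-modules. "`ℂ[ε]`-flat" for an `A`-module `P` is used in the
elementwise form `ker(ε •) = ε • P` (`hP₀`). Given a two-term resolution `0 → P₁ →φ P₀ → M → 0` of an `R`-module `M` of
projective dimension `≤ 1` (vector bundles; twisted ideal sheaves of Cohen–Macaulay codimension-2 subschemes by Hilbert–Burch;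
push-forwards of bundles from Cohen–Macaulay divisors), lift the projectives and the matrix to `φ̃ : P̃₁ → P̃₀` over `A`
(idempotents and maps from projectives lift along the nilpotent surjection `A → R`); "the reduction of `φ̃` mod `ε` is
injective" is `hred`. Then `φ̃` is injective (`liftedMap_injective`) and `coker φ̃` is `ℂ[ε]`-flat in the same elementwise
sense (`coker_liftedMap_flat`), so `coker φ̃` is a flat first-order lift of `M`: modules of projective dimension `≤ 1` are
NEVER locally obstructed along a first-order noncommutative deformation, in contrast with `bracket_mem_of_flat_cyclic_lift`.
This is the algebra behind "the proof is special to genus 3" (Abel–Jacobi curves in a threefold are codimension 2). -/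

variable {A : Type*} [Ring A] {P₁ P₀ : Type*} [AddCommGroup P₁] [Module A P₁] [AddCommGroup P₀] [Module A P₀]

/-- **Lemma J (i): a lift of an injective map of flat modules is injective.** If `ε² = 0`, `P₀` is `ε`-flat
(`ε • x = 0 → x ∈ ε • P₀`) and the reduction of `φ` mod `ε` is injective (`φ v ∈ ε • P₀ → v ∈ ε • P₁`), then `φ` is
injective. [cite: Toda2009DeformationsFM, §4] -/
theorem liftedMap_injective {ε : A} (hε2 : ε * ε = 0) (φ : P₁ →ₗ[A] P₀)
    (hP₀ : ∀ x : P₀, ε • x = 0 → ∃ y : P₀, x = ε • y)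
    (hred : ∀ v : P₁, (∃ y : P₀, φ v = ε • y) → ∃ u : P₁, v = ε • u) :
    Function.Injective φ := by
  rw [← LinearMap.ker_eq_bot, Submodule.eq_bot_iff]
  intro v hv
  rw [LinearMap.mem_ker] at hv
  obtain ⟨u, rfl⟩ := hred v ⟨0, by rw [hv, smul_zero]⟩
  have hu : ε • φ u = 0 := by rw [← map_smul, hv]
  obtain ⟨y, hy⟩ := hP₀ (φ u) hu
  obtain ⟨u', rfl⟩ := hred u ⟨y, hy⟩
  rw [smul_smul, hε2, zero_smul]

/-- **Lemma J (ii): the cokernel of the lifted map is flat.** Under the same hypotheses, `coker φ` is `ε`-flat: if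
`ε • w ∈ range φ` then `w ∈ range φ + ε • P₀`, i.e. `ker(ε • : coker φ → coker φ) = ε • coker φ`. Hence `coker φ` is a
`ℂ[ε]`-flat first-order lift of `coker(φ mod ε)`: objects of projective dimension `≤ 1` lift locally along every
first-order (noncommutative) deformation. [cite: Toda2009DeformationsFM, §4 and Prop. 6.1] -/
theorem coker_liftedMap_flat {ε : A} (φ : P₁ →ₗ[A] P₀)
    (hP₀ : ∀ x : P₀, ε • x = 0 → ∃ y : P₀, x = ε • y)
    (hred : ∀ v : P₁, (∃ y : P₀, φ v = ε • y) → ∃ u : P₁, v = ε • u)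
    {w : P₀} (hw : ε • w ∈ LinearMap.range φ) : ∃ v : P₁, ∃ y : P₀, w = φ v + ε • y := by
  obtain ⟨v, hv⟩ := LinearMap.mem_range.mp hw
  obtain ⟨u, rfl⟩ := hred v ⟨w, hv⟩
  rw [map_smul] at hv
  have h0 : ε • (w - φ u) = 0 := by rw [smul_sub, hv, sub_self]
  obtain ⟨y, hy⟩ := hP₀ (w - φ u) h0
  exact ⟨u, y, by rw [← hy, add_sub_cancel]⟩

end LocalLiftPdOne

end Literature.AlgebraicGeometry.HodgeTheory

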